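import Summits.KontsevichZagierPeriods.KontsevichZagierPeriods.Theorems.RootDecompWalshStrataPolarChart02

/-!
# The elliptic-polar chart, part 3/5: Lagrange normal form over `ℚ`; the engine on a chart domain

Declarations `Quad2` … `InBaker.of_psector` of the farm-checked gen-7 file `PolarChart.lean`: the Lagrange map (det 1)
bringing a binary rational quadratic polynomial with `d₁₁ ≠ 0`, `4d₁₁d₂₂ − d₁₂² ≠ 0` to `d₁₁X² + μY² + c`
(`Quad2.eval_eq_normal`; the dictionary `Quadric₃.dq`, `Quadric₃.Dxy_eq_dq`, `Quadric₃.Dxy_posdef`); preimages under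
`ℚ`-semialgebraic maps (`isSemialgebraic_sep_mem_map`); the chart domain `pchartDom κ₀ κ₁ T = {r > 0, Φ(t, r) ∈ T}`
(semialgebraic, open, `image_pΦ_pchartDom`, `pchartDom_subset_box`); the landed engine `InBaker.of_planar_sections` on a
chart domain (`InBaker.pchart_planar`) and the reduction of an open piece of the normalised sector `0 < Y < X`,
`κ₀X² + κ₁Y² < 1` to the boundary-section terms of the primitive (`InBaker.of_psector`).
See the module docstring of `RootDecompWalshStrataPolarChart01` (part 1). [KontsevichZagier2001 §1.2 rules (2),(3); BCR1998 §2.2; this node gen 7]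
-/

noncomputable section

open Set MeasureTheory MvPolynomial Literature.NumberTheory.Transcendental
open Literature.ModelTheory.ExponentialFields (IsSemialgebraic isSemialgebraic_univ)

namespace Summit.KontsevichZagierPeriods.RootDecompWalshStrata.ConicDescent.BallCube

variable {κ₀ κ₁ : ℚ}

/-! #### 32.7 Lagrange normal form over `ℚ` of a binary quadratic polynomial; the dictionary to `D` -/

/-- A rational quadratic polynomial in two variables
`q(x, y) = d₁₁x² + d₁₂xy + d₂₂y² + d₁x + d₂y + d₀`. [this node] -/
structure Quad2 where
  (d11 d12 d22 d1 d2 d0 : ℚ)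

namespace Quad2

variable (q : Quad2)

/-- Evaluation. [this node] -/
def eval (x y : ℝ) : ℝ :=
  (q.d11 : ℝ) * x ^ 2 + q.d12 * x * y + q.d22 * y ^ 2 + q.d1 * x + q.d2 * y + q.d0

/-- `4·d₁₁·(discriminant of the quadratic part)/4 = 4 d₁₁ d₂₂ − d₁₂²`. [this node] -/
def disc : ℚ := 4 * q.d11 * q.d22 - q.d12 ^ 2

/-- The second Lagrange weight `μ = (4 d₁₁ d₂₂ − d₁₂²)/(4 d₁₁)`. [this node] -/
def μ : ℚ := q.disc / (4 * q.d11)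

/-- The shifts `α = d₁/(2d₁₁)`, `β = (d₂ − d₁ d₁₂/(2 d₁₁))/(2μ)`. [this node] -/
def α : ℚ := q.d1 / (2 * q.d11)
/-- Auxiliary step `β`. [bookkeeping] -/
def β : ℚ := (q.d2 - q.d1 * q.d12 / (2 * q.d11)) / (2 * q.μ)

/-- The constant `c = d₀ − d₁₁α² − μβ²`. [this node] -/
def cst : ℚ := q.d0 - q.d11 * q.α ^ 2 - q.μ * q.β ^ 2

/-- The Lagrange map `(x, y) ↦ (x + (d₁₂/(2d₁₁)) y + α, y + β)` (unipotent, det 1). [this node] -/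
def lagM : AffMap := ⟨1, q.d12 / (2 * q.d11), 0, 1, q.α, q.β⟩

/-- Auxiliary step `lagM_det`. [bookkeeping] -/
theorem lagM_det : q.lagM.det = 1 := by
  simp [lagM, AffMap.det]

/-- Auxiliary step `μ_pos`. [bookkeeping] -/
theorem μ_pos (h11 : 0 < q.d11) (hdisc : 0 < q.disc) : 0 < q.μ :=
  div_pos hdisc (by linarith)

/-- Auxiliary step `μ_ne`. [bookkeeping] -/
theorem μ_ne (h11 : q.d11 ≠ 0) (hdisc : q.disc ≠ 0) : q.μ ≠ 0 :=
  div_ne_zero hdisc (by simpa using h11)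

/-- Auxiliary step `lag_id₁`. [bookkeeping] -/
theorem lag_id₁ (h11 : q.d11 ≠ 0) : 2 * q.d11 * (q.d12 / (2 * q.d11)) = q.d12 := by
  field_simp

/-- Auxiliary step `lag_id₂`. [bookkeeping] -/
theorem lag_id₂ (h11 : q.d11 ≠ 0) : q.d11 * (q.d12 / (2 * q.d11)) ^ 2 + q.μ = q.d22 := by
  simp only [μ, disc]
  field_simp
  ring

/-- Auxiliary step `lag_id₃`. [bookkeeping] -/
theorem lag_id₃ (h11 : q.d11 ≠ 0) : 2 * q.d11 * q.α = q.d1 := by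
  simp only [α]
  field_simp

/-- Auxiliary step `lag_id₄`. [bookkeeping] -/
theorem lag_id₄ (h11 : q.d11 ≠ 0) (hμ : q.μ ≠ 0) :
    2 * q.d11 * (q.d12 / (2 * q.d11)) * q.α + 2 * q.μ * q.β = q.d2 := by
  simp only [α, β]
  field_simp
  ring

/-- **Lagrange normal form:** for `d₁₁ ≠ 0` and non-degenerate quadratic part,
`q(x, y) = d₁₁ X² + μ Y² + c` with `(X, Y) = lagM (x, y)`. [Lagrange; this node] -/
theorem eval_eq_normal (h11 : q.d11 ≠ 0) (hdisc : q.disc ≠ 0) (x y : ℝ) :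
    q.eval x y = q.d11 * (q.lagM.toFun ![x, y] 0) ^ 2 + q.μ * (q.lagM.toFun ![x, y] 1) ^ 2 + q.cst := by
  have hμ : q.μ ≠ 0 := q.μ_ne h11 hdisc
  have h1 := congrArg (fun z : ℚ => (z : ℝ)) (q.lag_id₁ h11)
  have h2 := congrArg (fun z : ℚ => (z : ℝ)) (q.lag_id₂ h11)
  have h3 := congrArg (fun z : ℚ => (z : ℝ)) (q.lag_id₃ h11)
  have h4 := congrArg (fun z : ℚ => (z : ℝ)) (q.lag_id₄ h11 hμ)
  push_cast at h1 h2 h3 h4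
  simp only [eval, cst, lagM, AffMap.toFun_zero, AffMap.toFun_one, Matrix.cons_val_zero,
    Matrix.cons_val_one, Matrix.cons_val_fin_one]
  push_cast
  linear_combination (-(x * y)) * h1 + (-(y ^ 2)) * h2 + (-x) * h3 + (-y) * h4

/-- In particular for positive-definite quadratic part (`d₁₁ > 0`, `4d₁₁d₂₂ − d₁₂² > 0`) both
weights are positive. [this node] -/
theorem eval_eq_posdef (h11 : 0 < q.d11) (hdisc : 0 < q.disc) (x y : ℝ) :
    q.eval x y = q.d11 * (q.lagM.toFun ![x, y] 0) ^ 2 + q.μ * (q.lagM.toFun ![x, y] 1) ^ 2 + q.cst ∧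
      0 < q.d11 ∧ 0 < q.μ :=
  ⟨q.eval_eq_normal h11.ne' hdisc.ne' x y, h11, q.μ_pos h11 hdisc⟩

end Quad2

/-- The fibre discriminant `D` of a quadric in normal form as a `Quad2`:
`d₁₁ = b₁² − 4Ac₁₁`, `d₁₂ = 2b₁b₂ − 4Ac₁₂`, `d₂₂ = b₂² − 4Ac₂₂`, `d₁ = 2b₀b₁ − 4Ac₁`, `d₂ = 2b₀b₂ − 4Ac₂`,
`d₀ = b₀² − 4Ac₀` (cf. `Quadric₃.Dxy_eq`). [this node] -/
def Quadric₃.dq (K : Quadric₃) : Quad2 :=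
  ⟨K.b1 ^ 2 - 4 * K.A * K.c11, 2 * K.b1 * K.b2 - 4 * K.A * K.c12, K.b2 ^ 2 - 4 * K.A * K.c22,
    2 * K.b0 * K.b1 - 4 * K.A * K.c1, 2 * K.b0 * K.b2 - 4 * K.A * K.c2, K.b0 ^ 2 - 4 * K.A * K.c0⟩

/-- Auxiliary step `Dxy_eq_dq`. [bookkeeping] -/
theorem Quadric₃.Dxy_eq_dq (K : Quadric₃) (x y : ℝ) : K.Dxy x y = K.dq.eval x y := by
  simp only [Quadric₃.Dxy, Quadric₃.Bxy, Quadric₃.Cxy, Quad2.eval, Quadric₃.dq]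
  push_cast
  ring

/-- POSITIVE-DEFINITE quadratic part of `D`: the Lagrange map (det 1) brings `D` to
`κ₀X² + κ₁Y² + c` with `0 < κ₀`, `0 < κ₁` — the input shape of the elliptic-polar chart
(`pΦ_sq_add`, `InBaker.of_pchart_sqrt` with `a = 1`). [this node] -/
theorem Quadric₃.Dxy_posdef (K : Quadric₃) (h11 : 0 < K.dq.d11) (hdisc : 0 < K.dq.disc) (x y : ℝ) :
    K.Dxy x y = K.dq.d11 * (K.dq.lagM.toFun ![x, y] 0) ^ 2 + K.dq.μ * (K.dq.lagM.toFun ![x, y] 1) ^ 2 +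
      K.dq.cst := by
  rw [K.Dxy_eq_dq]
  exact K.dq.eval_eq_normal h11.ne' hdisc.ne' x y

/-! #### 32.8 The engine on a chart domain; an open piece of the sector `0 < Y < X` through the chart -/

/-- Preimages under `ℚ`-semialgebraic maps: `{x ∈ U | Φ x ∈ T}` is `ℚ`-semialgebraic (projection of
`graph Φ|_U ∩ (ℝᵐ × T)`, Tarski–Seidenberg; the tree has this only as non-exported lemmas of other routes,
e.g. `suspSA_isSemialgebraic_sep_mem`, whose proof is adapted here). [BCR1998 Prop. 2.2.7] -/
private theorem isSemialgebraic_sep_mem_map {m n : ℕ} {U : Set (Fin m → ℝ)}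
    {Φ : (Fin m → ℝ) → (Fin n → ℝ)} {T : Set (Fin n → ℝ)} (hΦsa : IsSemialgebraicMapOn ℚ U Φ)
    (hT : IsSemialgebraic ℚ T) : IsSemialgebraic ℚ {x | x ∈ U ∧ Φ x ∈ T} := by
  have hW : IsSemialgebraic ℚ
      ({z : Fin (m + n) → ℝ | ∃ x ∈ U, z = Fin.append x (Φ x)} ∩
        (fun z : Fin (m + n) → ℝ => z ∘ Fin.natAdd m) ⁻¹' T) :=
    Literature.ModelTheory.ExponentialFields.IsSemialgebraic.inter hΦsa
      (hT.preimage_comp (Fin.natAdd m))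
  convert hW.image_castAdd using 1
  ext x
  simp only [mem_setOf_eq, mem_image, mem_inter_iff, mem_preimage]
  constructor
  · rintro ⟨hxU, hxT⟩
    refine ⟨Fin.append x (Φ x), ⟨⟨x, hxU, rfl⟩, ?_⟩, ?_⟩
    · convert hxT using 1
      funext j
      simp
    · funext i
      simp
  · rintro ⟨z, ⟨⟨x', hx', rfl⟩, hzT⟩, rfl⟩
    have h1 : (fun i => Fin.append x' (Φ x') (Fin.castAdd n i)) = x' := by
      funext i
      simp
    rw [h1]
    refine ⟨hx', ?_⟩
    convert hzT using 1
    funext j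
    simp

/-- Auxiliary step `continuous_pΦ`. [bookkeeping] -/
theorem continuous_pΦ (hκ : 0 < κ₀ ∧ 0 ≤ κ₁) : Continuous (pΦ κ₀ κ₁) :=
  continuous_iff_continuousAt.2 fun p => (hasFDerivAt_pΦ hκ p).continuousAt

/-- `pos_one` is `ℚ`-semialgebraic. [BCR1998 §2.2] -/
private theorem isSemialgebraic_pos_one : IsSemialgebraic ℚ {p : Fin 2 → ℝ | 0 < p 1} := by
  simpa using Literature.ModelTheory.ExponentialFields.isSemialgebraic_setOf_eval_pos (k := ℚ)
    (R := ℝ) (X 1 : MvPolynomial (Fin 2) ℚ)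

/-- The chart domain over a target set `T`: `{(t, r) | r > 0, Φ(t, r) ∈ T}`. [this node] -/
def pchartDom (κ₀ κ₁ : ℚ) (T : Set (Fin 2 → ℝ)) : Set (Fin 2 → ℝ) :=
  {p | p ∈ {p : Fin 2 → ℝ | 0 < p 1} ∧ pΦ κ₀ κ₁ p ∈ T}

/-- `pchartDom ⊆ pos`. [bookkeeping] -/
theorem pchartDom_subset_pos (T : Set (Fin 2 → ℝ)) : pchartDom κ₀ κ₁ T ⊆ {p | 0 < p 1} :=
  fun _ hp => hp.1

/-- `pchartDom` is `ℚ`-semialgebraic. [BCR1998 §2.2] -/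
theorem isSemialgebraic_pchartDom (hκ : 0 < κ₀ ∧ 0 ≤ κ₁) {T : Set (Fin 2 → ℝ)}
    (hT : IsSemialgebraic ℚ T) : IsSemialgebraic ℚ (pchartDom κ₀ κ₁ T) :=
  isSemialgebraic_sep_mem_map (isSemialgebraicMapOn_pΦ hκ isSemialgebraic_pos_one) hT

/-- Auxiliary step `isOpen_pchartDom`. [bookkeeping] -/
theorem isOpen_pchartDom (hκ : 0 < κ₀ ∧ 0 ≤ κ₁) {T : Set (Fin 2 → ℝ)} (hT : IsOpen T) :
    IsOpen (pchartDom κ₀ κ₁ T) :=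
  (isOpen_lt continuous_const (continuous_apply 1)).inter (hT.preimage (continuous_pΦ hκ))

/-- Over a target inside `{X > 0}` the chart domain charts exactly the target. [this node] -/
theorem image_pΦ_pchartDom (hκ : 0 < κ₀ ∧ 0 ≤ κ₁) {T : Set (Fin 2 → ℝ)} (hT : T ⊆ {w | 0 < w 0}) :
    pΦ κ₀ κ₁ '' pchartDom κ₀ κ₁ T = T := by
  have h0 : (0 : ℝ) < κ₀ := by exact_mod_cast hκ.1
  have h1 : (0 : ℝ) ≤ κ₁ := by exact_mod_cast hκ.2
  rw [image_pΦ hκ (pchartDom_subset_pos T)]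
  ext w
  simp only [mem_setOf_eq, pchartDom]
  constructor
  · rintro ⟨hw0, -, hwT⟩
    rwa [pΦ_pΨ hκ hw0] at hwT
  · intro hwT
    have hw0 : 0 < w 0 := hT hwT
    refine ⟨hw0, ?_, by rwa [pΦ_pΨ hκ hw0]⟩
    rw [pΨ_one]
    exact Real.sqrt_pos.2 (by nlinarith [mul_nonneg h1 (sq_nonneg (w 1)), mul_pos h0 (pow_pos hw0 2)])

/-- The normalised sector target `0 < Y < X`, `κ₀X² + κ₁Y² < 1` charts into the open unit square
`0 < t < 1`, `0 < r < 1`. [this node] -/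
theorem pchartDom_subset_box (hκ : 0 < κ₀ ∧ 0 ≤ κ₁) {T : Set (Fin 2 → ℝ)}
    (hT : T ⊆ {w | 0 < w 1 ∧ w 1 < w 0 ∧ (κ₀ : ℝ) * w 0 ^ 2 + κ₁ * w 1 ^ 2 < 1}) :
    pchartDom κ₀ κ₁ T ⊆ {p | ∀ j, 0 < p j ∧ p j < 1} := by
  intro p hp
  obtain ⟨hr, hpT⟩ := hp
  replace hr : 0 < p 1 := hr
  obtain ⟨hY, hYX, hR⟩ := hT hpT
  have hX : 0 < pΦ κ₀ κ₁ p 0 := pΦ_zero_pos hκ hr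
  rw [pΦ_one_eq] at hY hYX
  have ht0 : 0 < p 0 := pos_of_mul_pos_right hY hX.le
  have ht1 : p 0 < 1 := by
    by_contra h
    push Not at h
    have : pΦ κ₀ κ₁ p 0 * 1 ≤ pΦ κ₀ κ₁ p 0 * p 0 := mul_le_mul_of_nonneg_left h hX.le
    linarith
  have hsq := pΦ_sq_add hκ p
  have hr1 : p 1 < 1 := by nlinarith
  exact Fin.forall_fin_two.2 ⟨⟨ht0, ht1⟩, hr, hr1⟩

/-- **The engine on a chart domain.** `[W, γ r √(a r² + c)/(κ₀ + κ₁t²)] ∈ InBaker` for an open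
`ℚ`-semialgebraic `W` in the unit square of the `(t, r)`-plane on which `a r² + c > 0`, GIVEN the
boundary-section terms `[S, P(x, ζ(x))]` of the primitive `P = ppot` (rule (3) in `r`, then the
`x`-ordered CAD of `W` — all inside the landed `InBaker.of_planar_sections`). [this node] -/
theorem InBaker.pchart_planar (hκ : 0 < κ₀ ∧ 0 ≤ κ₁) (γ a c : ℚ) (ha : a ≠ 0) {W : Set (Fin 2 → ℝ)}
    (hWo : IsOpen W) (hWs : IsSemialgebraic ℚ W) (hWI : W ⊆ Icc 0 1)
    (hD : ∀ p ∈ W, 0 < (a : ℝ) * p 1 ^ 2 + c) (ρ : KZ.IntegralRep 2) (hρ : ρ.domain = W)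
    (hρi : ∀ p ∈ W, ρ.integrand p = pweight κ₀ κ₁ γ a c p)
    (hsec : ∀ (S : Set (Fin 1 → ℝ)) (ζ : (Fin 1 → ℝ) → ℝ), IsSemialgebraic ℚ S →
      IsSemialgebraicFunOn ℚ S ζ → ContinuousOn ζ S → (∀ x ∈ S, Fin.snoc x (ζ x) ∈ frontier W) →
      ∀ r₁ : KZ.IntegralRep 1, r₁.domain = S →
        EqOn r₁.integrand (fun x => ppot κ₀ κ₁ γ a c (Fin.snoc x (ζ x))) S → InBaker (KZ.of r₁)) :
    InBaker (KZ.of ρ) :=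
  InBaker.of_planar_sections (N := 1) hWo hWs hWI (ppot κ₀ κ₁ γ a c)
    (isSemialgebraicFunOn_ppot hκ γ a c) (continuous_ppot hκ γ a c) ρ hρ
    (fun z hz => by rw [hρi z hz]; exact hasDerivAt_ppot_snoc hκ ha z (hD z hz)) hsec

/-- **An open piece of the normalised sector through the chart.** For an open `σ.domain` inside
`{0 < Y < X, κ₀X² + κ₁Y² < 1}` on which `a(κ₀X² + κ₁Y²) + c > 0`, the weight
`γ√(a(κ₀X² + κ₁Y²) + c)` is in `InBaker` as soon as the boundary-section terms of the primitive
`ppot` over the chart domain `pchartDom κ₀ κ₁ σ.domain` are (rule (2) for the chart `pΦ`, then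
`InBaker.pchart_planar`).  This is the typed form of GEN 8 MENU item (3) of the node for ONE
sector; the other three sectors and `r ≥ 1` are reached by the swaps / reflections / dilations of
`AffMap`. [KontsevichZagier2001 §1.2 rules (2),(3); this node] -/
theorem InBaker.of_psector (hκ : 0 < κ₀ ∧ 0 ≤ κ₁) (γ a c : ℚ) (ha : a ≠ 0) (σ : KZ.IntegralRep 2)
    (hσo : IsOpen σ.domain)
    (hσT : σ.domain ⊆ {w | 0 < w 1 ∧ w 1 < w 0 ∧ (κ₀ : ℝ) * w 0 ^ 2 + κ₁ * w 1 ^ 2 < 1})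
    (hD : ∀ w ∈ σ.domain, 0 < (a : ℝ) * (κ₀ * w 0 ^ 2 + κ₁ * w 1 ^ 2) + c)
    (hσi : ∀ w ∈ σ.domain, σ.integrand w = (γ : ℝ) * √(a * (κ₀ * w 0 ^ 2 + κ₁ * w 1 ^ 2) + c))
    (hsec : ∀ (S : Set (Fin 1 → ℝ)) (ζ : (Fin 1 → ℝ) → ℝ), IsSemialgebraic ℚ S →
      IsSemialgebraicFunOn ℚ S ζ → ContinuousOn ζ S →
      (∀ x ∈ S, Fin.snoc x (ζ x) ∈ frontier (pchartDom κ₀ κ₁ σ.domain)) →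
      ∀ r₁ : KZ.IntegralRep 1, r₁.domain = S →
        EqOn r₁.integrand (fun x => ppot κ₀ κ₁ γ a c (Fin.snoc x (ζ x))) S → InBaker (KZ.of r₁)) :
    InBaker (KZ.of σ) := by
  have hWs : IsSemialgebraic ℚ (pchartDom κ₀ κ₁ σ.domain) :=
    isSemialgebraic_pchartDom hκ σ.isSemialgebraic_domain
  have hWo : IsOpen (pchartDom κ₀ κ₁ σ.domain) := isOpen_pchartDom hκ hσo
  have hWB := pchartDom_subset_box hκ hσT
  have hWI : pchartDom κ₀ κ₁ σ.domain ⊆ Icc 0 1 := fun p hp =>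
    ⟨fun j => ((hWB hp) j).1.le, fun j => ((hWB hp) j).2.le⟩
  have hM : ∀ p ∈ pchartDom κ₀ κ₁ σ.domain,
      |pweight κ₀ κ₁ γ a c p| ≤ |(γ : ℝ)| * √(|(a : ℝ)| + |(c : ℝ)|) / κ₀ := fun p hp =>
    abs_pweight_le hκ γ a c ((hWB hp) 1).1.le ((hWB hp) 1).2.le
  have hb : Bornology.IsBounded (pchartDom κ₀ κ₁ σ.domain) :=
    (Metric.isBounded_Icc (0 : Fin 2 → ℝ) 1).subset hWI
  have hDW : ∀ p ∈ pchartDom κ₀ κ₁ σ.domain, 0 < (a : ℝ) * p 1 ^ 2 + c := fun p hp => by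
    rw [← pΦ_sq_add hκ p]; exact hD _ hp.2
  have hX : σ.domain ⊆ {w | 0 < w 0} := fun w hw => by
    obtain ⟨h1, h2, -⟩ := hσT hw
    exact h1.trans h2
  have hρB : InBaker (KZ.of (bddRep (pchartDom κ₀ κ₁ σ.domain) hWs hb (pweight κ₀ κ₁ γ a c)
      (isSemialgebraicFunOn_pweight hκ hWs γ a c) _ hM)) :=
    InBaker.pchart_planar hκ γ a c ha hWo hWs hWI hDW _ rfl (fun _ _ => rfl) hsec
  exact InBaker.of_pchart_sqrt hκ γ a c _ σ (pchartDom_subset_pos _)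
    (by rw [bddRep_domain, image_pΦ_pchartDom hκ hX]) (fun _ _ => rfl) hσi hρB

end Summit.KontsevichZagierPeriods.RootDecompWalshStrata.ConicDescent.BallCube
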